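import Summits.PneNP.PneNP.Theorems.SymmetryBudgetNoHiddenOrderPerPathRefine
import Summits.PneNP.PneNP.Theorems.SymmetryBudgetNoHiddenOrderPerPathProcess

/-!
# REPLAY: a height-coloured label re-runs the timed Corneil–Goldberg path exactly (`NoHiddenOrder`, PER-PATH.md §12)

Route `PneNP/SymmetryBudget`, `NoHiddenOrder` (stmt-PneNP-14781), brick B1 of (R2a). The components-only process on a coloured
graph: a STATE is a block with a colouring `(A, col)`; the OR-STEP at `x` refines `indiv col x` inside `A` (`refineIn`,
`…PerPathRefine.lean`) and passes to the atom of the pointer `v` (`atom`, `…PerPathAtomsDefs.lean`):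
`orStep G v (A, col) x = (atom G A (refineIn G A (indiv col x)) v, refineIn G A (indiv col x))`.

* `minColour A col`, `smallestCell A col` — the canonical FIRST SMALLEST CELL (least colour among the cells of least size);
  `minColour_mem`, `smallestCell_nonempty`, `card_smallestCell_le`, `smallestCell_eq_cellOf`.
* `timed G v St x k` — the state after the OR-choices `x 0, …, x (k-1)` from the start state `St`; `IsORChoice` — each `x k` is
  taken from the first smallest cell of a state with at least two vertices (the OR-nodes of the recursion tree along `v`'s path).
* `replay G S c v fuel St` — the LABEL-DRIVEN run: at a state with `≥ 2` vertices look at the label points `T = S ∩ smallestCell`;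
  if some point of `T` has strictly the largest colour, take the OR-step there, else stop.
* `HeightColoured x t c` — `c (x i) < c (x k)` whenever `k < i < t` and `x i` lies in the cell from which `x k` was taken (the
  height colouring of PER-PATH §12; entropy `≤ n + t + 2 Σ log₂ d`).
* **`replay_timed`** — for `S = {x k : k < t}` height-coloured, `replay G S c v fuel (timed … k) = timed … (min (k + fuel) t)`:
  the label replays the timed path EXACTLY and stops at its end (earlier points are gone — `x_not_mem_timed` via
  `not_mem_atom_of_cell_singleton` — and later points in the current smallest cell have smaller colours). In particular
  `replay_root : replay G S c v fuel St = timed G v St x t` for `fuel ≥ t`.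

This replaces the coherence theorem of PER-PATH §4 on the critical path of the canoniser: the semantics of a label is a composition
of `refineIn`, `atom` and `smallestCell`. Definitions are plain structural recursions (one `Classical.choose` of a provably unique
element).
-/

-- `Summit.PneNP.PneNP.…` duplicates `PneNP` BY DESIGN (single-problem summit, D-0017 layout).
set_option linter.dupNamespace false

namespace Summit.PneNP.PneNP.Theorems

open Finset

namespace BranchSum

variable {V : Type*} (G : SimpleGraph V) [DecidableRel G.Adj]

/-! ### The first smallest cell -/

/-- The least size of a cell of `(A, col)` (`0` if `A = ∅`). -/
noncomputable def minCellCard (A : Finset V) (col : V → ℕ) : ℕ :=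
  if h : A.Nonempty then ((A.image col).image fun k => (A.filter fun w => col w = k).card).min'
    (by obtain ⟨a, ha⟩ := h; exact ⟨_, mem_image_of_mem _ (mem_image_of_mem col ha)⟩) else 0

/-- The colour of the FIRST SMALLEST CELL: the least colour among the cells of least size (`0` if `A = ∅`). -/
noncomputable def minColour (A : Finset V) (col : V → ℕ) : ℕ :=
  if h : ((A.image col).filter fun k => (A.filter fun w => col w = k).card = minCellCard A col).Nonempty then
    ((A.image col).filter fun k => (A.filter fun w => col w = k).card = minCellCard A col).min' h else 0

/-- The first smallest cell of `(A, col)`. -/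
noncomputable def smallestCell (A : Finset V) (col : V → ℕ) : Finset V := A.filter fun w => col w = minColour A col

variable {G}

/-- The least cell size is attained. -/
theorem exists_card_eq_minCellCard {A : Finset V} (col : V → ℕ) (hA : A.Nonempty) :
    ∃ k ∈ A.image col, (A.filter fun w => col w = k).card = minCellCard A col := by
  unfold minCellCard
  rw [dif_pos hA]
  exact mem_image.1 (min'_mem _ _)

/-- Every cell has at least the least size. -/
theorem minCellCard_le {A : Finset V} (col : V → ℕ) {a : V} (ha : a ∈ A) :
    minCellCard A col ≤ (A.filter fun w => col w = col a).card := by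
  unfold minCellCard
  rw [dif_pos ⟨a, ha⟩]
  exact min'_le _ _ (mem_image_of_mem _ (mem_image_of_mem col ha))

/-- The colour of the first smallest cell occurs (for `A ≠ ∅`). -/
theorem minColour_mem {A : Finset V} (col : V → ℕ) (hA : A.Nonempty) :
    minColour A col ∈ A.image col ∧ (A.filter fun w => col w = minColour A col).card = minCellCard A col := by
  obtain ⟨k, hk, hkeq⟩ := exists_card_eq_minCellCard col hA
  have hne : ((A.image col).filter fun k => (A.filter fun w => col w = k).card = minCellCard A col).Nonempty :=
    ⟨k, mem_filter.2 ⟨hk, hkeq⟩⟩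
  unfold minColour
  rw [dif_pos hne]
  exact mem_filter.1 (min'_mem _ hne)

/-- The first smallest cell is non-empty (for `A ≠ ∅`). -/
theorem smallestCell_nonempty {A : Finset V} (col : V → ℕ) (hA : A.Nonempty) : (smallestCell A col).Nonempty := by
  obtain ⟨hmem, -⟩ := minColour_mem col hA
  obtain ⟨a, ha, hak⟩ := mem_image.1 hmem
  exact ⟨a, mem_filter.2 ⟨ha, hak⟩⟩

/-- `smallestCell ⊆ A`. -/
theorem smallestCell_subset (A : Finset V) (col : V → ℕ) : smallestCell A col ⊆ A := filter_subset _ _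

/-- The first smallest cell is a smallest cell. -/
theorem card_smallestCell_le {A : Finset V} (col : V → ℕ) {a : V} (ha : a ∈ A) :
    (smallestCell A col).card ≤ (cellOf A col a).card := by
  unfold smallestCell cellOf
  rw [(minColour_mem col ⟨a, ha⟩).2]
  exact minCellCard_le col ha

/-- The first smallest cell is the cell of each of its members. -/
theorem smallestCell_eq_cellOf {A : Finset V} (col : V → ℕ) {x : V} (hx : x ∈ smallestCell A col) :
    smallestCell A col = cellOf A col x := by
  have hxk : col x = minColour A col := (mem_filter.1 hx).2
  unfold smallestCell cellOf
  rw [hxk]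

variable [DecidableEq V]

/-! ### States, OR-steps, the timed path -/

variable (G)

/-- The OR-STEP at `x` for the pointer `v`: refine the individualised colouring inside the block, pass to the atom of `v`. -/
noncomputable def orStep (v : V) (St : Finset V × (V → ℕ)) (x : V) : Finset V × (V → ℕ) :=
  (atom G St.1 (refineIn G St.1 (indiv St.2 x)) v, refineIn G St.1 (indiv St.2 x))

/-- The state after the OR-choices `x 0, …, x (k-1)` from the start state `St`. -/
noncomputable def timed (v : V) (St : Finset V × (V → ℕ)) (x : ℕ → V) : ℕ → Finset V × (V → ℕ)
  | 0 => St
  | k + 1 => orStep G v (timed v St x k) (x k)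

/-- The choices are OR-choices: each `x k`, `k < t`, lies in the first smallest cell of a state with at least two vertices. -/
def IsORChoice (v : V) (St : Finset V × (V → ℕ)) (x : ℕ → V) (t : ℕ) : Prop :=
  ∀ k, k < t → 2 ≤ (timed G v St x k).1.card ∧ x k ∈ smallestCell (timed G v St x k).1 (timed G v St x k).2

/-- The label-driven REPLAY with fuel: at a state with at least two vertices, if among the label points in the first smallest
cell exactly one has no other point of colour `≥` its own, take the OR-step there; otherwise stop. -/
noncomputable def replay (S : Finset V) (c : V → ℕ) (v : V) : ℕ → Finset V × (V → ℕ) → Finset V × (V → ℕ)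
  | 0, St => St
  | fuel + 1, St =>
    if h : 2 ≤ St.1.card ∧
        ((smallestCell St.1 St.2 ∩ S).filter fun y => ∀ y' ∈ smallestCell St.1 St.2 ∩ S, y' ≠ y → c y' < c y).card = 1 then
      replay S c v fuel (orStep G v St (Finset.card_eq_one.1 h.2).choose)
    else St

/-- HEIGHT COLOURING of the points w.r.t. the timed path: a later point in the cell from which `x k` was taken has a smaller
colour. -/
def HeightColoured (v : V) (St : Finset V × (V → ℕ)) (x : ℕ → V) (t : ℕ) (c : V → ℕ) : Prop :=
  ∀ k i, k < i → i < t → x i ∈ cellOf (timed G v St x k).1 (timed G v St x k).2 (x k) → c (x i) < c (x k)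

variable {G}

/-! ### Replay exactness -/

section Exact

variable {v : V} {St : Finset V × (V → ℕ)} {x : ℕ → V} {t : ℕ}

/-- Unfolding `timed`. -/
theorem timed_succ (k : ℕ) : timed G v St x (k + 1) = orStep G v (timed G v St x k) (x k) := rfl

/-- Blocks shrink along the timed path. -/
theorem timed_fst_subset_of_le {k k' : ℕ} (h : k ≤ k') : (timed G v St x k').1 ⊆ (timed G v St x k).1 := by
  induction h with
  | refl => exact Subset.rfl
  | step _ ih => exact (atom_subset _ _ _).trans ih

/-- **The individualised vertex is dropped at once**: `x k ∉ (timed (k+1)).1`, provided `x k ≠ v` and `x k` lies in the block. -/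
theorem x_not_mem_timed_succ {k : ℕ} (hxk : x k ∈ (timed G v St x k).1) (hxv : x k ≠ v) :
    x k ∉ (timed G v St x (k + 1)).1 := by
  rw [timed_succ, orStep]
  set A := (timed G v St x k).1
  set col := (timed G v St x k).2
  exact not_mem_atom_of_cell_singleton
    (fun u hu u' hu' huu' w hw => equitableIn_refineIn (G := G) A (indiv col (x k)) hu hu' huu' hw)
    hxk (cellOf_refineIn_indiv col hxk) hxv

/-- Hence an OR-choice is absent from every later block. -/
theorem x_not_mem_timed_of_lt (hOR : IsORChoice G v St x t) (hv : ∀ k, k < t → x k ≠ v) {k k' : ℕ} (hk : k < k') (hkt : k < t) :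
    x k ∉ (timed G v St x k').1 := fun h =>
  x_not_mem_timed_succ (smallestCell_subset _ _ (hOR k hkt).2) (hv k hkt) (timed_fst_subset_of_le (Nat.succ_le_of_lt hk) h)

/-- The OR-choices of a path are pairwise distinct. -/
theorem x_injective (hOR : IsORChoice G v St x t) (hv : ∀ k, k < t → x k ≠ v) {i k : ℕ} (hi : i < t) (hk : k < t)
    (h : x i = x k) : i = k := by
  rcases Nat.lt_trichotomy i k with hik | rfl | hki
  · exact absurd (h ▸ smallestCell_subset _ _ (hOR k hk).2) (x_not_mem_timed_of_lt hOR hv hik hi)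
  · rfl
  · exact absurd (h.symm ▸ smallestCell_subset _ _ (hOR i hi).2) (x_not_mem_timed_of_lt hOR hv hki hk)

/-- At the timed state `k < t`, the unique label point of the first smallest cell with no rival of colour `≥` is `x k`. -/
theorem filter_max_eq_singleton (hOR : IsORChoice G v St x t) (hv : ∀ k, k < t → x k ≠ v) {c : V → ℕ}
    (hc : HeightColoured G v St x t c) {k : ℕ} (hk : k < t) :
    ((smallestCell (timed G v St x k).1 (timed G v St x k).2 ∩ (range t).image x).filter fun y =>
        ∀ y' ∈ smallestCell (timed G v St x k).1 (timed G v St x k).2 ∩ (range t).image x, y' ≠ y → c y' < c y) = {x k} := by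
  set A := (timed G v St x k).1 with hA
  set col := (timed G v St x k).2 with hcol
  set C := smallestCell A col with hC
  have hxC : x k ∈ C := (hOR k hk).2
  -- the label points in `C` are `x k` and later points, all of smaller colour
  have hT : ∀ y ∈ C ∩ (range t).image x, y = x k ∨ c y < c (x k) := by
    intro y hy
    rw [mem_inter, mem_image] at hy
    obtain ⟨hyC, i, hi, rfl⟩ := hy
    rw [mem_range] at hi
    rcases Nat.lt_trichotomy i k with hik | rfl | hki
    · exact absurd (smallestCell_subset _ _ hyC) (x_not_mem_timed_of_lt hOR hv hik hi)
    · exact Or.inl rfl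
    · right
      refine hc k i hki hi ?_
      rw [← smallestCell_eq_cellOf col hxC]; exact hyC
  ext y
  rw [mem_filter, mem_singleton]
  constructor
  · rintro ⟨hy, hmax⟩
    rcases hT y hy with h | h
    · exact h
    · exfalso
      have hxT : x k ∈ C ∩ (range t).image x := mem_inter.2 ⟨hxC, mem_image.2 ⟨k, mem_range.2 hk, rfl⟩⟩
      have := hmax (x k) hxT (fun heq => by rw [heq] at h; exact lt_irrefl _ h)
      omega
  · rintro rfl
    refine ⟨mem_inter.2 ⟨hxC, mem_image.2 ⟨k, mem_range.2 hk, rfl⟩⟩, fun y' hy' hne => ?_⟩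
    rcases hT y' hy' with h | h
    · exact absurd h hne
    · exact h

/-- **Replay exactness**: driven by the height-coloured label of its own OR-choices, the replay from the timed state `k ≤ t` with
fuel `f` reaches the timed state `min (k + f) t` — it re-takes every timed OR-step and stops at the end of the path. -/
theorem replay_timed (hOR : IsORChoice G v St x t) (hv : ∀ k, k < t → x k ≠ v) {c : V → ℕ}
    (hc : HeightColoured G v St x t c) (f : ℕ) {k : ℕ} (hk : k ≤ t) :
    replay G ((range t).image x) c v f (timed G v St x k) = timed G v St x (min (k + f) t) := by
  induction f generalizing k with
  | zero => simp [replay, Nat.min_eq_left hk]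
  | succ f ih =>
    rcases Nat.lt_or_ge k t with hkt | hkt
    · -- an OR-node of the path: the replay takes the timed step
      have hM := filter_max_eq_singleton hOR hv hc hkt
      have hcond : 2 ≤ (timed G v St x k).1.card ∧
          ((smallestCell (timed G v St x k).1 (timed G v St x k).2 ∩ (range t).image x).filter fun y =>
            ∀ y' ∈ smallestCell (timed G v St x k).1 (timed G v St x k).2 ∩ (range t).image x, y' ≠ y → c y' < c y).card = 1 :=
        ⟨(hOR k hkt).1, by rw [hM, card_singleton]⟩
      rw [replay, dif_pos hcond]
      have hchoose : (Finset.card_eq_one.1 hcond.2).choose = x k :=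
        singleton_inj.1 ((Finset.card_eq_one.1 hcond.2).choose_spec.symm.trans hM)
      rw [hchoose, ← timed_succ, ih (Nat.succ_le_of_lt hkt)]
      congr 1; omega
    · -- the end of the path: no label point is left in the block
      have hkt' : k = t := le_antisymm hk hkt
      subst hkt'
      have hstop : ¬ (2 ≤ (timed G v St x k).1.card ∧
          ((smallestCell (timed G v St x k).1 (timed G v St x k).2 ∩ (range k).image x).filter fun y =>
            ∀ y' ∈ smallestCell (timed G v St x k).1 (timed G v St x k).2 ∩ (range k).image x, y' ≠ y → c y' < c y).card = 1) := by
        rintro ⟨-, hcard⟩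
        obtain ⟨y, hy⟩ := Finset.card_eq_one.1 hcard
        have hyT : y ∈ (smallestCell (timed G v St x k).1 (timed G v St x k).2 ∩ (range k).image x) := by
          have : y ∈ ({y} : Finset V) := mem_singleton_self y
          rw [← hy, mem_filter] at this
          exact this.1
        rw [mem_inter, mem_image] at hyT
        obtain ⟨hyC, i, hi, rfl⟩ := hyT
        rw [mem_range] at hi
        exact x_not_mem_timed_of_lt hOR hv hi hi (smallestCell_subset _ _ hyC)
      rw [replay, dif_neg hstop]
      simp

/-- **From the start**: with fuel `≥ t` the replay ends exactly at the end of the timed path. -/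
theorem replay_root (hOR : IsORChoice G v St x t) (hv : ∀ k, k < t → x k ≠ v) {c : V → ℕ}
    (hc : HeightColoured G v St x t c) {f : ℕ} (hf : t ≤ f) :
    replay G ((range t).image x) c v f St = timed G v St x t := by
  have := replay_timed hOR hv hc f (Nat.zero_le t)
  rw [Nat.zero_add, Nat.min_eq_right hf] at this
  exact this

end Exact

end BranchSum

end Summit.PneNP.PneNP.Theorems
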